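import Summits.QuantumFields.BalabanUV.Beta.EriceRemainderEnclosureHistoryAutonomyComparisonAgeCompositionThreeAgesDefectAbs
import Mathlib.Analysis.Convex.SpecificFunctions.Basic
import Mathlib.Analysis.Convex.Jensen

/-!
# EriceRemainderEnclosureHistoryAutonomyComparisonAgeCompositionThreeAgesDefectGeomMean — (E88b) route (N), first order, THREE loaded ages: the envelope
# inequality (★h°[gU]) of (E88a) FROM ITS «B-FORM» — the defect-weighted SUM over the old lags bounded below by `k₃` times the GEOMETRIC MEAN of its rows
# (uniform Jensen over the `k₃` old lags, the `r·gU`-weighted first-row term dropped), the one reduction of the sum that stays k-uniform in the census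

Cell `pub-balaban`, β-function sub-cell, BINDER row D4 «RemainderConst leaves for Bałaban's split» (`HOME/BINDER-OWNERS.md`; owner lineage `b2b-balaban-beta-an4`;
this file by co-owner #2 lineage `b2b-balaban-beta-d4-p2`, generation 79), β-FLOW TEAM duty (1), FREEZE (0) honoured (def-free; imports (E87p) (for the lineage chain) and Mathlib's
Jensen inequality `ConvexOn.map_sum_le` for `convexOn_exp`; nothing restated).

HONEST FRAMING (page 1, verbatim and binding).  *"Discharging BetaPertH makes Bałaban's UV stability UNCONDITIONAL — a real constructive-QFT result; it is
NOT the continuum limit and NOT the Clay problem."*  THIS FILE DISCHARGES NOTHING OF THE KIND.  Elementary real analysis (the arithmetic–geometric mean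
inequality and bookkeeping) about displayed letters — hypotheses of a census, not facts; the form, signs, ages and moments of Bałaban's (1.22) limit functional
are NOT PRINTED ([I] p. 298; GAPS G-t4-U2-1∕-2) and NOT asserted.  Row D4 class UNCHANGED (critical-path width 0; instance 0∕1; D4 DISCHARGE NO DATE).
HONEST DEPENDENCY: continuum YM on T⁴ ⇐ BetaPertH ∧ nine spine estimates (0/9 proved); BetaPertH ⇐ (D1) ∧ (D4) ∧ CAP+tail; G-an2-4 gates asym, D1 and NE2/3/4.

THE POINT (census sense (α); route (N); README `HOME/b2b-balaban-beta-d4-p2/g79/e88/README.md` §3).  (★h°[gU]) reads `L ≤ (1 − r·gU₁)·Σ_{l'<k₃} T_{l'} +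
r·gU₁·T′₀` with the rows `T_{l'} = Pf(m+1+l',m+k₃)·ALa_j(m+1+l')` (old floor × young floor row).  Towards an additive budget along flows the sum must be turned
into a product.  Census (README §3; young-saturated infrared corner, `k₂ = k₃−1`, `m = 0`, `gU = 1∕(1+F♭)`): Jensen over ALL `k₃+1` weighted terms is NOT
k-uniform (the first-row term carries weight ≈ ½ and decays like `k₃^{−1∕3}`: margin `0.53∕0.41∕0.29∕0.19∕0.09∕0.01` at `k₃ = 32…1024`), whereas DROPPING the
`r·gU₁`-term and taking the UNIFORM geometric mean of the `k₃` rows keeps `0.263∕0.234∕0.218∕0.210∕0.206∕0.204` (exact: `0.59 … 0.34`) — k-uniform ≈ 0.20;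
on the whole affine census grid the same form is never violated (kit j336874, README §3).  §1 **`card_mul_exp_mean_log_le_sum`** (`n·exp((Σ_{i<n} log T_i)∕n) ≤
Σ_{i<n} T_i` for positive `T`: Jensen for `exp`); §2 **`weighted_sum_of_geom`** (abstract bookkeeping); §3 **`env_product_of_geom_mean`**: (★h°[gU]) at `(m, j)`
FROM the «B-form» `r·gU₁·q_{n₀}·Σ_{l<k₂}[⋯]·Π gU ≤ (1 − r·gU₁)·k₃·exp((1∕k₃)·Σ_{l'<k₃} log(Pf(m+1+l',m+k₃)·ALa_j(m+1+l')))` (rows positive).  NOT CLAIMED: the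
B-form along flows (successor: its logarithm is ADDITIVE in the letters except for the one factor `k₃(1 − r·gU₁)`); anything nonlinear; anything printed — NOT B12
Thm 2, NOT BetaPertH.

WHAT IS PROVED ([folklore]; 0 `def`, 0 sorry).  §1 **`card_mul_exp_mean_log_le_sum`**; §2 `weighted_sum_of_geom`; §3 **`env_product_of_geom_mean`**.
-/
noncomputable section
open Finset

namespace Summit.QuantumFields.BalabanUV.Beta.EriceRemainderEnclosureHistoryAutonomyComparisonAgeCompositionThreeAgesDefectGeomMean

/-! ## §1 The arithmetic–geometric mean inequality in the form used -/

/-- **`n·exp(mean log) ≤ sum`**: for positive `T_0,…,T_{n−1}` (`n ≥ 1`), `n·exp((Σ_{i<n} log T_i)∕n) ≤ Σ_{i<n} T_i` — Jensen's inequality for the convex `exp`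
(Mathlib `ConvexOn.map_sum_le`, `convexOn_exp`) with uniform weights. [folklore] -/
theorem card_mul_exp_mean_log_le_sum {n : ℕ} (hn : 1 ≤ n) {T : ℕ → ℝ} (hT : ∀ i ∈ range n, 0 < T i) :
    (n : ℝ) * Real.exp ((∑ i ∈ range n, Real.log (T i)) / n) ≤ ∑ i ∈ range n, T i := by
  have hn0 : (0 : ℝ) < n := by exact_mod_cast (show 0 < n by omega)
  have hJ := (convexOn_exp).map_sum_le (t := range n) (w := fun _ => (1 : ℝ) / n) (p := fun i => Real.log (T i))
    (fun _ _ => by positivity) (by rw [sum_const, card_range, nsmul_eq_mul]; field_simp) (fun _ _ => Set.mem_univ _)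
  simp only [smul_eq_mul] at hJ
  have e1 : ∑ i ∈ range n, 1 / (n : ℝ) * Real.log (T i) = (∑ i ∈ range n, Real.log (T i)) / n := by
    rw [← mul_sum]; ring
  have e2 : ∑ i ∈ range n, 1 / (n : ℝ) * Real.exp (Real.log (T i)) = (∑ i ∈ range n, T i) / n := by
    rw [← mul_sum, sum_congr rfl fun i hi => Real.exp_log (hT i hi)]; ring
  rw [e1, e2, le_div_iff₀ hn0] at hJ
  linarith

/-! ## §2 Bookkeeping: a weighted sum below its uniform geometric part -/

/-- If `X ≤ w_d·(n·exp(mean log T))` with `w_d, w_0, B ≥ 0` and positive rows `T`, then `X ≤ w_d·Σ T + w_0·B`. [folklore] -/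
theorem weighted_sum_of_geom {n : ℕ} (hn : 1 ≤ n) {wd w0 X B : ℝ} {T : ℕ → ℝ} (hwd : 0 ≤ wd) (hw0 : 0 ≤ w0) (hB : 0 ≤ B)
    (hT : ∀ i ∈ range n, 0 < T i) (hX : X ≤ wd * ((n : ℝ) * Real.exp ((∑ i ∈ range n, Real.log (T i)) / n))) :
    X ≤ wd * ∑ i ∈ range n, T i + w0 * B := by
  have h1 := mul_le_mul_of_nonneg_left (card_mul_exp_mean_log_le_sum hn hT) hwd
  have h2 : 0 ≤ w0 * B := mul_nonneg hw0 hB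
  linarith

/-! ## §3 (★h°[gU]) from the B-form -/

/-- **(★h°[gU]) AT `(m, j)` FROM THE B-FORM.**  Letters of (E88a): `r = (h_{m+k₃+1}∕h_{m+k₃})³`, `gU₁ = gU_{m+k₃+1}`, `n₀ = m+1+k₃`, old floors `Pf`, young
floor rows `ALa_j`.  IF the rows `T_{l'} = Pf(m+1+l',m+k₃)·ALa_j(m+1+l')` are positive, `0 ≤ r·gU₁ ≤ 1`, `Pf(m+1,m+k₃)·ALa_j(m+1) ≥ 0`, and the **B-FORM**
`r·gU₁·q_{n₀}·Σ_{l<k₂} [m+2+k₃+l ≤ j]·Π_{t∈[n₀+1+l,n₀+k₂]} gU_t ≤ (1 − r·gU₁)·k₃·exp((1∕k₃)·Σ_{l'<k₃} log T_{l'})` holds, THEN (★h°[gU]) holds at `(m, j)` (the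
`hprod` of (E88a) `static_defect_abs_of_product_env` ∕ `flow_nonneg_three_ages_of_product_abs_env` at this pin and truncation). [folklore] -/
theorem env_product_of_geom_mean {h gU q : ℕ → ℝ} {Pf ALa : ℕ → ℕ → ℝ} {k₂ k₃ m j : ℕ} (hk3 : 1 ≤ k₃)
    (hw0 : 0 ≤ (h (m + k₃ + 1) / h (m + k₃)) ^ 3 * gU (m + k₃ + 1)) (hw1 : (h (m + k₃ + 1) / h (m + k₃)) ^ 3 * gU (m + k₃ + 1) ≤ 1)
    (hT : ∀ l' ∈ range k₃, 0 < Pf (m + 1 + l') (m + k₃) * ALa j (m + 1 + l')) (hB : 0 ≤ Pf (m + 1) (m + k₃) * ALa j (m + 1))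
    (hgeom : (h (m + k₃ + 1) / h (m + k₃)) ^ 3 * gU (m + k₃ + 1) * q (m + 1 + k₃) *
          (∑ l ∈ range k₂, if m + 2 + k₃ + l ≤ j then ∏ t ∈ Ico (m + 1 + k₃ + 1 + l) (m + 1 + k₃ + k₂ + 1), gU t else 0) ≤
        (1 - (h (m + k₃ + 1) / h (m + k₃)) ^ 3 * gU (m + k₃ + 1)) *
          ((k₃ : ℝ) * Real.exp ((∑ l' ∈ range k₃, Real.log (Pf (m + 1 + l') (m + k₃) * ALa j (m + 1 + l'))) / k₃))) :
    (h (m + k₃ + 1) / h (m + k₃)) ^ 3 * gU (m + k₃ + 1) * q (m + 1 + k₃) *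
        (∑ l ∈ range k₂, if m + 2 + k₃ + l ≤ j then ∏ t ∈ Ico (m + 1 + k₃ + 1 + l) (m + 1 + k₃ + k₂ + 1), gU t else 0) ≤
      (1 - (h (m + k₃ + 1) / h (m + k₃)) ^ 3 * gU (m + k₃ + 1)) * ∑ l' ∈ range k₃, Pf (m + 1 + l') (m + k₃) * ALa j (m + 1 + l') +
        (h (m + k₃ + 1) / h (m + k₃)) ^ 3 * gU (m + k₃ + 1) * (Pf (m + 1) (m + k₃) * ALa j (m + 1)) :=
  weighted_sum_of_geom (T := fun l' => Pf (m + 1 + l') (m + k₃) * ALa j (m + 1 + l')) hk3 (by linarith) hw0 hB hT hgeom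

end Summit.QuantumFields.BalabanUV.Beta.EriceRemainderEnclosureHistoryAutonomyComparisonAgeCompositionThreeAgesDefectGeomMean

end
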